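import Summits.QuantumFields.YangMills.Theses.PencilRigidity
import Summits.QuantumFields.YangMills.Theses.MirrorModularBoosts
import Summits.QuantumFields.YangMills.Theorems.MirrorModularBoostsHypercubicLimitPlaneLimitsDefs
import Summits.QuantumFields.YangMills.Theorems.MirrorModularBoostsHypercubicLimitClosureHalvesDefs
import Summits.QuantumFields.YangMills.Theorems.CoincidenceRotationBootstrapHypercubicLimitOneFieldWeak
import Summits.QuantumFields.YangMills.Theorems.HypercubicLimit.Negative.ExtendByZero
import Summits.QuantumFields.YangMills.Theorems.PencilRigidityDiagonalMirrorRPRStubRpClosureDefs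
import HarnessLib

/-!
# Packaging for the FOLD crux `WeakCouplingHypercubicLimitRP`: a one-field witness with diagonal-frame RP suffices

Helper file for crux stmt-QuantumFields-27398 (`PencilRigidity.WeakCouplingHypercubicLimitRP`, line `Sketch`, §12 of the
re-registered skeleton; FOLD shape F, director-ym O4 WORD 1–2, 2026-08-31) and its MirrorModularBoosts / IsotropyFromPowerCounting
twin stmt-QuantumFields-27395.

The FOLD crux is the old existence leg `WeakCouplingHypercubicLimit` (now an aside) with ONE conjunct inserted after
`sch.HasWeakCouplingLimit ∧`: reflection positivity of the curvature channel `n ↦ S n (curvature,…)` of THE SAME witness in pull-back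
form `∘ linActMulti R` for every frame `R e₀ = a e₀ + b e₁`, `a² = b² = ½`.  For a ONE-FIELD family `S₁` that conjunct is literally the
landed predicate `Cruxes.DiagonalMirrorRPR.ParityBridgeColdTraces.DiagonalFrameRP S₁` (cited, not restated).  This file proves the
species bookkeeping step of the line once and for all:

* `weakCouplingHypercubicLimitRP_of_oneFieldRP` — a weak-coupling one-field witness `(r, sch, S₁)` with
  `OneFieldClauses r sch S₁ ∧ DiagonalFrameRP S₁` gives `PencilRigidity.WeakCouplingHypercubicLimitRP` (one-field gauge): silence every
  species other than the curvature (`c ↦ 0` there keeps `β`, hence the weak-coupling clause, and `(a, L)`, hence `HasLatticeMassGap`),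
  extend the family by zero (`extendByZero`: E0–E4 by `osClauses_extendByZero`, the gap by `hasMassGap_extendByZero`, the NEW conjunct by
  `extendByZero_const`, the one-field bullet by `extendByZero_of_not_all`, convergence by `latticeSchwinger_silence_self` / `_of_ne`);
* `weakCouplingHypercubicLimitRP_mmb_of_oneFieldRP` — the same for `MirrorModularBoosts.WeakCouplingHypercubicLimitRP` (no one-field bullet).

So the line's remaining obligations are exactly: the disjoint RP core (heart S6i `stub_rpCoreDisjoint`) and the diagonal-frame RP of the
constructed plane-limit family (D1 `stub_diagRPOfPlaneLimits`).  Pattern of the landed `hypercubicLimit_iff_oneFieldWeak`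
(`Theorems/CoincidenceRotationBootstrapHypercubicLimitOneFieldWeak.lean`).  HONEST LABEL: bookkeeping only; nothing here proves the
crux; the Yang–Mills mass gap is NOT proved.  Refs: OsterwalderSchrader1973 §2; OsterwalderSeiler1978 §2; GlimmJaffe1987 §6.1.
-/

noncomputable section

open scoped SchwartzMap
open MeasureTheory Filter Topology Complex
open Literature.MathematicalPhysics.AQFT Literature.MathematicalPhysics.QuantumLattice
open Literature.MathematicalPhysics.QuantumFieldTheory
open Summit.QuantumFields.YangMills.Theorems.HypercubicLimit.Negative
open Summit.QuantumFields.YangMills.Theorems.HypercubicLimit.OneFieldWeak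

namespace Summit.QuantumFields.YangMills.Theorems.WeakCouplingHypercubicLimit.TraceNormColdPressure

open Summit.QuantumFields.YangMills.Cruxes.HypercubicLimit.CouplingResponse
-- The new conjunct for a one-field family = the LANDED decl (Theorems/PencilRigidityDiagonalMirrorRPRStubRpClosureDefs.lean): cited.
open Summit.QuantumFields.YangMills.Cruxes.DiagonalMirrorRPR.ParityBridgeColdTraces (DiagonalFrameRP)

/-- **Packaging (PencilRigidity copy, one-field gauge).**  A one-field weak-coupling witness with the one-field clauses AND
diagonal-frame reflection positivity gives the FOLD crux `PencilRigidity.WeakCouplingHypercubicLimitRP` (stmt-QuantumFields-27398):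
silence every species other than the curvature, extend the family by zero; the new conjunct is read off `DiagonalFrameRP S₁` through
`extendByZero_const`. [folklore] -/
theorem weakCouplingHypercubicLimitRP_of_oneFieldRP
    (h : ∀ (G : Type) [Group G] [TopologicalSpace G] [IsTopologicalGroup G] [CompactSpace G],
      IsCompactSimpleLieGroup G →
        letI : MeasurableSpace G := borel G
        haveI : BorelSpace G := ⟨rfl⟩
        ∃ (r : LatticeRep G) (sch : SpeciesScheme (YMSpecies G)) (S₁ : SchwingerFamily (EuclideanSpace ℝ (Fin 4))),
          sch.HasWeakCouplingLimit ∧ OneFieldClauses r sch S₁ ∧ DiagonalFrameRP S₁) :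
    Summit.QuantumFields.YangMills.Theses.PencilRigidity.WeakCouplingHypercubicLimitRP := fun G _ _ _ _ hG => by
  letI : MeasurableSpace G := borel G
  haveI : BorelSpace G := ⟨rfl⟩
  obtain ⟨r, sch, S₁, hw, ⟨hos, hconv, hnt, hng, Δ, hΔ, hgap, hlat⟩, hdiag⟩ := h G hG
  refine ⟨r, { sch with c := fun s k => by classical exact if s = r.curvature then sch.c s k else 0 },
    extendByZero r.curvature S₁, hw, ?_, ?_,
    osClauses_extendByZero hos, ?_, ?_, ?_, Δ, hΔ, hasMassGap_extendByZero hgap, hlat⟩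
  · -- the NEW conjunct: diagonal-frame RP of the curvature channel of the witness
    intro R a b ha hb hR
    simp only [extendByZero_const]
    exact hdiag R a b ha hb hR
  · -- one-field gauge
    rintro n k ⟨i, hi⟩ F
    rw [extendByZero_of_not_all _ _ (fun hall => hi (hall i))]
    rfl
  · intro n hn σ f F hF hod
    by_cases hσ : ∀ i, σ i = r.curvature
    · obtain rfl : σ = fun _ => r.curvature := funext hσ
      rw [extendByZero_const]
      simp_rw [latticeSchwinger_silence_self]
      exact hconv n hn f F hF hod
    · push Not at hσ
      obtain ⟨i₀, hi₀⟩ := hσ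
      rw [extendByZero_of_not_all _ _ (fun hall => hi₀ (hall i₀))]
      simp_rw [latticeSchwinger_silence_of_ne r sch r.curvature _ n σ f hi₀]
      simp
  · simpa using hnt
  · simpa using hng

/-- **Packaging (MirrorModularBoosts / IsotropyFromPowerCounting copy).**  The same one-field witness gives the shared twin crux
`MirrorModularBoosts.WeakCouplingHypercubicLimitRP` (stmt-QuantumFields-27395; no one-field bullet). [folklore] -/
theorem weakCouplingHypercubicLimitRP_mmb_of_oneFieldRP
    (h : ∀ (G : Type) [Group G] [TopologicalSpace G] [IsTopologicalGroup G] [CompactSpace G],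
      IsCompactSimpleLieGroup G →
        letI : MeasurableSpace G := borel G
        haveI : BorelSpace G := ⟨rfl⟩
        ∃ (r : LatticeRep G) (sch : SpeciesScheme (YMSpecies G)) (S₁ : SchwingerFamily (EuclideanSpace ℝ (Fin 4))),
          sch.HasWeakCouplingLimit ∧ OneFieldClauses r sch S₁ ∧ DiagonalFrameRP S₁) :
    Summit.QuantumFields.YangMills.Theses.MirrorModularBoosts.WeakCouplingHypercubicLimitRP := fun G _ _ _ _ hG => by
  letI : MeasurableSpace G := borel G
  haveI : BorelSpace G := ⟨rfl⟩
  obtain ⟨r, sch, S₁, hw, ⟨hos, hconv, hnt, hng, Δ, hΔ, hgap, hlat⟩, hdiag⟩ := h G hG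
  refine ⟨r, { sch with c := fun s k => by classical exact if s = r.curvature then sch.c s k else 0 },
    extendByZero r.curvature S₁, hw, ?_,
    osClauses_extendByZero hos, ?_, ?_, ?_, Δ, hΔ, hasMassGap_extendByZero hgap, hlat⟩
  · -- the NEW conjunct: diagonal-frame RP of the curvature channel of the witness
    intro R a b ha hb hR
    simp only [extendByZero_const]
    exact hdiag R a b ha hb hR
  · intro n hn σ f F hF hod
    by_cases hσ : ∀ i, σ i = r.curvature
    · obtain rfl : σ = fun _ => r.curvature := funext hσ
      rw [extendByZero_const]
      simp_rw [latticeSchwinger_silence_self]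
      exact hconv n hn f F hF hod
    · push Not at hσ
      obtain ⟨i₀, hi₀⟩ := hσ
      rw [extendByZero_of_not_all _ _ (fun hall => hi₀ (hall i₀))]
      simp_rw [latticeSchwinger_silence_of_ne r sch r.curvature _ n σ f hi₀]
      simp
  · simpa using hnt
  · simpa using hng

/-- **The PencilRigidity copy implies the MirrorModularBoosts copy** (drop the one-field bullet): the two FOLD cruxes differ exactly as
stmt-16120 and stmt-16154 did. [folklore] -/
theorem weakCouplingHypercubicLimitRP_mmb_of_pr
    (h : Summit.QuantumFields.YangMills.Theses.PencilRigidity.WeakCouplingHypercubicLimitRP) :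
    Summit.QuantumFields.YangMills.Theses.MirrorModularBoosts.WeakCouplingHypercubicLimitRP := fun G _ _ _ _ hG => by
  obtain ⟨r, sch, S, hweak, hRP, -, hrest⟩ := h G hG
  exact ⟨r, sch, S, hweak, hRP, hrest⟩

end Summit.QuantumFields.YangMills.Theorems.WeakCouplingHypercubicLimit.TraceNormColdPressure

end
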